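import Mathlib.FieldTheory.Finite.GaloisField
import Mathlib.Algebra.CharP.Lemmas
import Mathlib.LinearAlgebra.Matrix.CharP

/-!
# Frobenius‑unitriangular matrices over `𝔽_{2^{2^e}}` and their power law `M^{2^e} = 1 + λ(M)^{2^{2^e}-1}·E₀ₜ`

COR-CM (cell `pub-hodgecm2`), count-neutral kernel combinatorics by the census seat lit-andre-3 (gen 24; lane
TYPE-STABILISER-UNBOUNDED, first leaf = the matrix algebra), used by `Census/TypeStabiliserUnbounded.lean` (the group `𝒰ₑ`, its
central involution `c` and `d₂(𝒰ₑ/𝒦) ≥ 2^e`).  Pure matrix algebra over a finite field; bookkeeping definitions with bodies (a field,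
a matrix shape, two matrix coefficients, the corner matrix, a `Set` of matrices, a unit) + theorems, everything proved; no `Prop`-valued
definition, no `decide`, no certificate, no named fact, no `sorry`.
HONEST FRAMING: `HC_CM` is NOT proved, here or anywhere in the tree; nothing here is a period or a headline.

CONTENT.  `k = Fq e = 𝔽_{2^t}` with `t = 2^e` (`GaloisField 2 (2^e)`), `Mat e` the `(t+1)×(t+1)` matrices over `k`,
`sd M r = M_{r,r+1}` the superdiagonal, `λ(M) = lam M = M_{0,1}`, `cornerE = E₀ₜ`.
* §1 **`good e`** = the upper unitriangular matrices whose superdiagonal is a Frobenius orbit, `M_{r,r+1} = λ(M)^{2^r}` (other entries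
  free).  It contains `1` and is closed under products (`one_mem_good`, `mul_mem_good`, `pow_mem_good`): the superdiagonal of a product of
  unitriangular matrices is the sum of the superdiagonals (`sd_mul`, `lam_mul`) and `x ↦ x^{2^r}` is additive in characteristic `2`.
* §2 **THE POWER LAW** `M^{2^e} = 1 + λ(M)^{2^{2^e}-1} · E₀ₜ` for `M ∈ good e` (`pow_two_pow`): `M = 1 + X` with `X` strictly upper
  triangular, `(1+X)^{2^e} = 1 + X^{2^e}` (`add_pow_char_pow_of_commute`), and column `s` of `X^s` is `(∏_{r<s} X_{r,r+1})·e₀ =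
  λ^{2^s-1}·e₀` (`pow_sub_one_apply_col`, `pow_apply_eq_zero_of_lt`), so `X^{2^e} = λ^{2^{2^e}-1}·E₀ₜ` (`sub_one_pow`).  Consequences:
  `M^{2^{e+1}} = 1` (`pow_two_pow_succ`; so `M` is a unit with inverse `M^{2^{e+1}-1}`, `goodUnit`), `E₀ₜ² = 0`, `(1 + a·E₀ₜ)² = 1`, and
  `M·E₀ₜ = E₀ₜ = E₀ₜ·M` (`mul_cornerE`, `cornerE_mul`: `1 + E₀ₜ` is central among unitriangular matrices).
The sequel turns this into the root law «`u^{2^e} = c` for every `u` with `λ(u) ≠ 0`» of a finite `2`-group, since `λ^{2^t-1} = 1` on `k^×`.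

## References
* [Pohlmann1968] H. Pohlmann, Algebraic cycles on abelian varieties of complex multiplication type, Ann. of Math. 88 (1968), Thm 1
  (context only: the census objects this lane serves; nothing of it is used here).
-/

namespace Summit.HodgeConjecture.CorCM.Census.TypeStabiliser

noncomputable section

namespace FrobUT

variable (e : ℕ)

/-! ## §1 Frobenius‑unitriangular matrices over `𝔽_{2^{2^e}}` -/

/-- The field with `2^(2^e)` elements. [folklore] -/
abbrev Fq : Type := GaloisField 2 (2 ^ e)

/-- Square matrices of size `2^e + 1` over `Fq e`. [folklore] -/
abbrev Mat : Type := Matrix (Fin (2 ^ e + 1)) (Fin (2 ^ e + 1)) (Fq e)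

/-- The superdiagonal of a matrix: `sd M r = M_{r,r+1}`. [folklore] -/
def sd (M : Mat e) (r : Fin (2 ^ e)) : Fq e := M r.castSucc r.succ

/-- The scalar `λ(M) = M_{0,1}`. [folklore] -/
def lam (M : Mat e) : Fq e := sd e M ⟨0, Nat.two_pow_pos e⟩

/-- The corner matrix unit `E_{0,t}`, `t = 2^e`. [folklore] -/
def cornerE : Mat e := Matrix.of fun a b : Fin (2 ^ e + 1) => if a = 0 ∧ b = Fin.last (2 ^ e) then (1 : Fq e) else 0

/-- **Frobenius‑unitriangular matrices**: the set of upper unitriangular matrices with superdiagonal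
`M_{r,r+1} = λ(M)^{2^r}`. [folklore] -/
def good : Set (Mat e) :=
  {M | (∀ i, M i i = 1) ∧ (∀ i j : Fin (2 ^ e + 1), (j : ℕ) < i → M i j = 0) ∧
    ∀ r : Fin (2 ^ e), sd e M r = lam e M ^ (2 ^ (r : ℕ))}

variable {e}

/-- `r ≠ r + 1` as elements of `Fin (n+1)`. [folklore] -/
theorem castSucc_ne_succ {n : ℕ} (r : Fin n) : r.castSucc ≠ r.succ := ne_of_lt Fin.castSucc_lt_succ

section Accessors

variable {M : Mat e} (hM : M ∈ good e)
include hM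

/-- Diagonal entries of a Frobenius‑unitriangular matrix are `1`. [folklore] -/
theorem diag_of_mem (i : Fin (2 ^ e + 1)) : M i i = 1 := hM.1 i

/-- Entries below the diagonal of a Frobenius‑unitriangular matrix vanish. [folklore] -/
theorem lower_of_mem {i j : Fin (2 ^ e + 1)} (h : (j : ℕ) < i) : M i j = 0 := hM.2.1 i j h

/-- The superdiagonal of a Frobenius‑unitriangular matrix is `λ^{2^r}`. [folklore] -/
theorem super_of_mem (r : Fin (2 ^ e)) : sd e M r = lam e M ^ (2 ^ (r : ℕ)) := hM.2.2 r

end Accessors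

/-- Entries of the corner matrix `E₀ₜ`. [folklore] -/
theorem cornerE_apply (a b : Fin (2 ^ e + 1)) :
    cornerE e a b = if a = 0 ∧ b = Fin.last (2 ^ e) then (1 : Fq e) else 0 := rfl

/-- `t ≠ 0` in `Fin (t+1)`, `t = 2^e`. [folklore] -/
theorem last_ne_zero : Fin.last (2 ^ e) ≠ (0 : Fin (2 ^ e + 1)) := by
  intro h
  have := congrArg Fin.val h
  rw [Fin.val_last, Fin.val_zero] at this
  exact pow_ne_zero e two_ne_zero this

/-- The superdiagonal of `1` vanishes. [folklore] -/
theorem sd_one (r : Fin (2 ^ e)) : sd e (1 : Mat e) r = 0 :=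
  Matrix.one_apply_ne (castSucc_ne_succ r)

/-- `λ(1) = 0`. [folklore] -/
theorem lam_one : lam e (1 : Mat e) = 0 := sd_one _

/-- The identity matrix is Frobenius‑unitriangular. [folklore] -/
theorem one_mem_good : (1 : Mat e) ∈ good e :=
  ⟨fun i => Matrix.one_apply_eq i,
    fun i j h => Matrix.one_apply_ne fun hij => by
      subst hij
      exact lt_irrefl _ h,
    fun r => by rw [sd_one, lam_one, zero_pow (pow_ne_zero _ two_ne_zero)]⟩

section Mul

variable {M N : Mat e} (hM : M ∈ good e) (hN : N ∈ good e)
include hM hN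

/-- Diagonal entries of a product of unitriangular matrices are `1`. [folklore] -/
theorem mul_apply_diag (i : Fin (2 ^ e + 1)) : (M * N) i i = 1 := by
  rw [Matrix.mul_apply, Finset.sum_eq_single i]
  · rw [diag_of_mem hM, diag_of_mem hN, one_mul]
  · intro m _ hm
    rcases Nat.lt_or_gt_of_ne (Fin.val_injective.ne hm) with h | h
    · rw [lower_of_mem hM h, zero_mul]
    · rw [lower_of_mem hN h, mul_zero]
  · intro h
    exact absurd (Finset.mem_univ i) h

/-- A product of upper unitriangular matrices is upper triangular. [folklore] -/
theorem mul_apply_lower {i j : Fin (2 ^ e + 1)} (hij : (j : ℕ) < i) : (M * N) i j = 0 := by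
  rw [Matrix.mul_apply]
  refine Finset.sum_eq_zero fun m _ => ?_
  by_cases h : (m : ℕ) < i
  · rw [lower_of_mem hM (j := m) h, zero_mul]
  · rw [lower_of_mem hN (i := m) (j := j) (by omega), mul_zero]

/-- The superdiagonal of a product of unitriangular matrices is the sum of the superdiagonals. [folklore] -/
theorem sd_mul (r : Fin (2 ^ e)) : sd e (M * N) r = sd e M r + sd e N r := by
  unfold sd
  rw [Matrix.mul_apply, Fintype.sum_eq_add (Fin.castSucc r) (Fin.succ r)]
  · rw [diag_of_mem hM, one_mul, diag_of_mem hN, mul_one, add_comm]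
  · exact (castSucc_ne_succ r)
  · rintro m ⟨h1, h2⟩
    have h1' : (m : ℕ) ≠ r := fun h => h1 (Fin.ext (by rw [h, Fin.val_castSucc]))
    have h2' : (m : ℕ) ≠ r + 1 := fun h => h2 (Fin.ext (by rw [h, Fin.val_succ]))
    rcases Nat.lt_or_gt_of_ne h1' with h | h
    · rw [lower_of_mem hM (j := m) (by rw [Fin.val_castSucc]; exact h), zero_mul]
    · rw [lower_of_mem hN (i := m) (by rw [Fin.val_succ]; omega), mul_zero]

/-- **`λ` is additive**: `λ(MN) = λ(M) + λ(N)`. [folklore] -/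
theorem lam_mul : lam e (M * N) = lam e M + lam e N :=
  sd_mul hM hN _

/-- Frobenius‑unitriangular matrices are closed under multiplication (additivity of `x ↦ x^{2^r}` in characteristic `2`).
[folklore] -/
theorem mul_mem_good : M * N ∈ good e :=
  ⟨mul_apply_diag hM hN, fun _ _ h => mul_apply_lower hM hN h, fun r => by
    rw [sd_mul hM hN, super_of_mem hM, super_of_mem hN, lam_mul hM hN, add_pow_char_pow]⟩

end Mul

/-- Powers of a Frobenius‑unitriangular matrix are Frobenius‑unitriangular. [folklore] -/
theorem pow_mem_good {M : Mat e} (hM : M ∈ good e) : ∀ k : ℕ, M ^ k ∈ good e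
  | 0 => by
    rw [pow_zero]
    exact one_mem_good
  | k + 1 => by
    rw [pow_succ]
    exact mul_mem_good (pow_mem_good hM k) hM

/-! ## §2 The power law `u^{2^e} = 1 + λ(u)^{2^{2^e}-1}·E₀ₜ` -/

section PowerLaw

variable {M : Mat e} (hM : M ∈ good e)
include hM

/-- `M - 1` is strictly upper triangular. [folklore] -/
theorem sub_one_apply {i j : Fin (2 ^ e + 1)} (h : (j : ℕ) ≤ i) : (M - 1) i j = 0 := by
  rw [Matrix.sub_apply]
  rcases h.lt_or_eq with h | h
  · rw [lower_of_mem hM h, Matrix.one_apply_ne, sub_zero]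
    intro hij
    subst hij
    exact lt_irrefl _ h
  · have hji : j = i := Fin.ext h
    subst hji
    rw [diag_of_mem hM, Matrix.one_apply_eq, sub_self]

/-- The superdiagonal of `M - 1` is that of `M`. [folklore] -/
theorem sd_sub_one (r : Fin (2 ^ e)) : sd e (M - 1) r = lam e M ^ (2 ^ (r : ℕ)) := by
  unfold sd
  rw [Matrix.sub_apply, Matrix.one_apply_ne (castSucc_ne_succ r), sub_zero]
  exact super_of_mem hM r

omit hM in
/-- Powers of a strictly upper triangular matrix: `(X^s)_{i,j} = 0` for `j < s`. [folklore] -/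
theorem pow_apply_eq_zero_of_lt {X : Mat e} (hX : ∀ i j : Fin (2 ^ e + 1), (j : ℕ) ≤ i → X i j = 0) :
    ∀ (s : ℕ) (i j : Fin (2 ^ e + 1)), (j : ℕ) < s → (X ^ s) i j = 0
  | 0, _, _, h => absurd h (Nat.not_lt_zero _)
  | s + 1, i, j, h => by
    rw [pow_succ, Matrix.mul_apply]
    refine Finset.sum_eq_zero fun m _ => ?_
    by_cases hm : (j : ℕ) ≤ m
    · rw [hX m j hm, mul_zero]
    · rw [pow_apply_eq_zero_of_lt hX s i m (by omega), zero_mul]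

omit hM in
/-- Powers of `M - 1`: the column `s` of `(M-1)^s` is `λ(M)^{2^s-1}` in row `0` and `0` below. [folklore] -/
theorem pow_sub_one_apply_col {M : Mat e} (hM : M ∈ good e) :
    ∀ (s : ℕ) (hs : s < 2 ^ e + 1) (i : Fin (2 ^ e + 1)),
      ((M - 1) ^ s) i ⟨s, hs⟩ = if (i : ℕ) = 0 then lam e M ^ (2 ^ s - 1) else 0
  | 0, hs, i => by
    rw [pow_zero, pow_zero, Nat.sub_self, pow_zero, Matrix.one_apply]
    by_cases h : (i : ℕ) = 0
    · rw [if_pos h, if_pos (Fin.ext h)]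
    · rw [if_neg h, if_neg (fun hi => h (by rw [hi]))]
  | s + 1, hs, i => by
    rw [pow_succ, Matrix.mul_apply, Finset.sum_eq_single ⟨s, by omega⟩]
    · rw [pow_sub_one_apply_col hM s (by omega) i]
      have hsd : (M - 1) ⟨s, by omega⟩ ⟨s + 1, hs⟩ = lam e M ^ (2 ^ s) := sd_sub_one hM ⟨s, by omega⟩
      rw [hsd]
      split_ifs with h
      · rw [← pow_add]
        congr 1
        have := Nat.two_pow_pos s
        rw [pow_succ]
        omega
      · rw [zero_mul]
    · intro m _ hm
      have hm' : (m : ℕ) ≠ s := fun h => hm (Fin.ext h)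
      rcases Nat.lt_or_gt_of_ne hm' with h | h
      · rw [pow_apply_eq_zero_of_lt (fun a b hab => sub_one_apply hM hab) s i m h, zero_mul]
      · rw [sub_one_apply hM (show ((⟨s + 1, hs⟩ : Fin (2 ^ e + 1)) : ℕ) ≤ m from h), mul_zero]
    · intro h
      exact absurd (Finset.mem_univ _) h

/-- `(M - 1)^{2^e} = λ(M)^{2^{2^e}-1} · E₀ₜ`. [folklore] -/
theorem sub_one_pow : (M - 1) ^ (2 ^ e) = (lam e M ^ (2 ^ (2 ^ e) - 1)) • cornerE e := by
  ext i j
  rw [Matrix.smul_apply, cornerE_apply, smul_eq_mul]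
  by_cases hj : (j : ℕ) < 2 ^ e
  · rw [pow_apply_eq_zero_of_lt (fun a b hab => sub_one_apply hM hab) (2 ^ e) i j hj, if_neg, mul_zero]
    rintro ⟨-, h⟩
    rw [h, Fin.val_last] at hj
    exact lt_irrefl _ hj
  · have hj' : j = Fin.last (2 ^ e) := Fin.ext (by rw [Fin.val_last]; have := j.isLt; omega)
    subst hj'
    rw [show Fin.last (2 ^ e) = ⟨2 ^ e, Nat.lt_succ_self _⟩ from rfl,
      pow_sub_one_apply_col hM (2 ^ e) (Nat.lt_succ_self _) i]
    by_cases hi : (i : ℕ) = 0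
    · have hi' : i = 0 := Fin.ext (by rw [Fin.val_zero]; exact hi)
      rw [if_pos hi, if_pos ⟨hi', rfl⟩, mul_one]
    · rw [if_neg hi, if_neg, mul_zero]
      rintro ⟨h, -⟩
      apply hi
      rw [h, Fin.val_zero]

/-- **THE POWER LAW**: `M^{2^e} = 1 + λ(M)^{2^{2^e}-1} · E₀ₜ` for every Frobenius‑unitriangular `M`. [folklore] -/
theorem pow_two_pow : M ^ (2 ^ e) = 1 + (lam e M ^ (2 ^ (2 ^ e) - 1)) • cornerE e := by
  have h := add_pow_char_pow_of_commute 2 e (Commute.one_left (M - 1))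
  rw [add_sub_cancel, one_pow] at h
  rw [h, sub_one_pow hM]

omit hM in
/-- `E₀ₜ² = 0`. [folklore] -/
theorem cornerE_mul_cornerE : cornerE e * cornerE e = 0 := by
  ext a b
  rw [Matrix.mul_apply, Matrix.zero_apply]
  refine Finset.sum_eq_zero fun m _ => ?_
  rw [cornerE_apply, cornerE_apply]
  by_cases hm : m = 0
  · exact mul_eq_zero_of_left (if_neg (show ¬(a = 0 ∧ m = Fin.last (2 ^ e)) from
      fun h => last_ne_zero (h.2.symm.trans hm))) _
  · exact mul_eq_zero_of_right _ (if_neg (show ¬(m = 0 ∧ b = Fin.last (2 ^ e)) from fun h => hm h.1))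

omit hM in
/-- `(1 + a·E₀ₜ)² = 1` in characteristic `2`. [folklore] -/
theorem one_add_smul_cornerE_sq (a : Fq e) : (1 + a • cornerE e) * (1 + a • cornerE e) = 1 := by
  have h2 : (1 + a • cornerE e) ^ 2 = 1 ^ 2 + (a • cornerE e) ^ 2 :=
    add_pow_char_of_commute 2 (Commute.one_left (a • cornerE e))
  rw [pow_two, pow_two, pow_two, one_mul, Matrix.smul_mul, Matrix.mul_smul, cornerE_mul_cornerE, smul_zero,
    smul_zero, add_zero] at h2
  exact h2

/-- `M^{2^{e+1}} = 1`: every Frobenius‑unitriangular matrix has order dividing `2^{e+1}`. [folklore] -/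
theorem pow_two_pow_succ : M ^ (2 ^ (e + 1)) = 1 := by
  rw [pow_succ, pow_mul, pow_two_pow hM, sq, one_add_smul_cornerE_sq]

/-- A Frobenius‑unitriangular matrix as a unit (its inverse is a power of it). [folklore] -/
def goodUnit : (Mat e)ˣ :=
  ⟨M, M ^ (2 ^ (e + 1) - 1),
    by rw [← pow_succ', Nat.sub_add_cancel Nat.one_le_two_pow, pow_two_pow_succ hM],
    by rw [← pow_succ, Nat.sub_add_cancel Nat.one_le_two_pow, pow_two_pow_succ hM]⟩

/-- The unit `goodUnit hM` has underlying matrix `M`. [folklore] -/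
@[simp] theorem val_goodUnit : (goodUnit hM : Mat e) = M := rfl

/-- Column `0` of a unitriangular matrix. [folklore] -/
theorem col_zero (a : Fin (2 ^ e + 1)) : M a 0 = if a = 0 then 1 else 0 := by
  split_ifs with h
  · subst h
    exact diag_of_mem hM 0
  · exact lower_of_mem hM (by
      rw [Fin.val_zero]
      exact Nat.pos_of_ne_zero fun h0 => h (Fin.ext (by rw [h0, Fin.val_zero])))

/-- Row `last` of a unitriangular matrix. [folklore] -/
theorem row_last (b : Fin (2 ^ e + 1)) :
    M (Fin.last (2 ^ e)) b = if b = Fin.last (2 ^ e) then 1 else 0 := by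
  split_ifs with h
  · subst h
    exact diag_of_mem hM _
  · exact lower_of_mem hM (by
      rw [Fin.val_last]
      exact lt_of_le_of_ne (Nat.le_of_lt_succ b.isLt) fun h' => h (Fin.ext (by rw [h', Fin.val_last])))

/-- `E₀ₜ` is absorbed on both sides by unitriangular matrices: `M · E₀ₜ = E₀ₜ`. [folklore] -/
theorem mul_cornerE : M * cornerE e = cornerE e := by
  ext a b
  rw [Matrix.mul_apply, Finset.sum_eq_single (0 : Fin (2 ^ e + 1)), col_zero hM, cornerE_apply, cornerE_apply]
  · by_cases ha : a = 0
    · by_cases hb : b = Fin.last (2 ^ e)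
      · rw [if_pos ha, if_pos ⟨rfl, hb⟩, if_pos ⟨ha, hb⟩, one_mul]
      · rw [if_pos ha, if_neg (show ¬((0 : Fin (2 ^ e + 1)) = 0 ∧ b = Fin.last (2 ^ e)) from fun h => hb h.2),
          if_neg (show ¬(a = 0 ∧ b = Fin.last (2 ^ e)) from fun h => hb h.2), mul_zero]
    · rw [if_neg ha, zero_mul, if_neg (show ¬(a = 0 ∧ b = Fin.last (2 ^ e)) from fun h => ha h.1)]
  · intro m _ hm
    rw [cornerE_apply, if_neg (show ¬(m = 0 ∧ b = Fin.last (2 ^ e)) from fun h => hm h.1), mul_zero]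
  · intro h
    exact absurd (Finset.mem_univ _) h

/-- `E₀ₜ · M = E₀ₜ`. [folklore] -/
theorem cornerE_mul : cornerE e * M = cornerE e := by
  ext a b
  rw [Matrix.mul_apply, Finset.sum_eq_single (Fin.last (2 ^ e)), row_last hM, cornerE_apply, cornerE_apply]
  · by_cases ha : a = 0
    · by_cases hb : b = Fin.last (2 ^ e)
      · rw [if_pos ⟨ha, rfl⟩, if_pos hb, if_pos ⟨ha, hb⟩, one_mul]
      · rw [if_neg hb, mul_zero, if_neg (show ¬(a = 0 ∧ b = Fin.last (2 ^ e)) from fun h => hb h.2)]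
    · rw [if_neg (show ¬(a = 0 ∧ Fin.last (2 ^ e) = Fin.last (2 ^ e)) from fun h => ha h.1), zero_mul,
        if_neg (show ¬(a = 0 ∧ b = Fin.last (2 ^ e)) from fun h => ha h.1)]
  · intro m _ hm
    rw [cornerE_apply, if_neg (show ¬(a = 0 ∧ m = Fin.last (2 ^ e)) from fun h => hm h.2), zero_mul]
  · intro h
    exact absurd (Finset.mem_univ _) h

end PowerLaw

end FrobUT

end

end Summit.HodgeConjecture.CorCM.Census.TypeStabiliser
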